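import Literature.AnabelianGeometry.EtaleTheta.TemperedFrobenioidCnst
import Literature.AnabelianGeometry.EtaleTheta.RealifiedDivisorMonoidsOfRlfR
import Literature.AnabelianGeometry.EtaleTheta.FrdIVocabulary
import Literature.AlgebraicGeometry.Frobenioids.PiMonoprimePerfFactorial
import Literature.AlgebraicGeometry.Frobenioids.SupportsRealPowLinear
import Literature.AlgebraicGeometry.Frobenioids.PerfectionPrimes
import HarnessLib

/-!
# [EtTh] Prop 3.4 (ii) / Def 3.6 (i), monoid type `ℝ`: the effective-locus clause of `Prop34Cnst` does NOT
# transport from the `B₀`-level to `B₀^ℝ = ℝ·Φ₀^birat` — a kernel counterexample over abstract data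

NEGATIVE companion (a counterexample; carries the definitions of its witness) in the series `Discharge/Sec3*.lean`,
cell abc-iut, sub-DAG `plan/L2/SUBDAG-EtTh-Thm37.md`, row «EtTh:Thm3.7(iii)/L10-R».  S. Mochizuki, *The étale theta
function …*, Publ. RIMS **45** (2009) [EtTh], §3, Prop. 3.4 (ii) p.74, Def. 3.6 (i) p.76 (PDF) [cite: MochizukiEtTh2009,
Prop 3.4 (ii) p.74]: "`B₀^Λ` for `B₀` (resp. `B₀^pf`; `ℝ·Φ₀^birat`) if `Λ = ℤ` (resp. `ℚ`; `ℝ`), `F₀^Λ ⊆ B₀^Λ` for `F₀`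
(resp. `F₀^pf`; `ℝ·Φ₀^cnst`)".  The row asked for `dm.Prop34 V V₀ → dm.Prop34Cnst₀ cnst → (ofRlfR dm hpf).Prop34Cnst
cnst` (the `Λ = ℝ` analogue of `RealifiedDivisorMonoids.Prop34Cnst.ofRlfZ`); clause 1 of the conclusion reads "an
element of `ℝ·Φ₀^birat(Y)` with EFFECTIVE image in `(Φ₀^rlf)^gp(Y)` lies in `ℝ·Φ₀^cnst(Y)`".  THIS FILE: that clause
does not follow over ABSTRACT Def. 3.3 (iii) data (`DivisorMonoids` + `Prop34` over the TREE's [FrdI] vocabulary +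
`Prop34Cnst₀`).  Witness `dm₀` over the one-object base: `Φ₀ := ℝ_{≥0}³` (full product of perfect `ℝ`-monoprime
monoids: perf-factorial by `PiMonoprime.isPerfFactorial`, and `ℝ` supports it), `B₀ := ℤ²` with `div₀(e₁) = u :=
(1,-1,0)`, `div₀(e₂) = v := (√2,-√2,1)` (additive coordinates), `F₀ := 0`.  `Prop34` HOLDS (`a·u + b·v = (a + b√2,
-(a + b√2), b)` is effective only for `a = b = 0`, `√2` being irrational), `Prop34Cnst₀ (𝟭 _)` holds trivially, but
`β := v - √2·u = (0,0,1) ∈ ℝ·Φ₀^birat` is effective and nonzero while `ℝ·Φ₀^cnst = 0`: `not_prop34Cnst_ofRlfR`, hence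
**`not_forall_prop34Cnst_ofRlfR`** — the row's implication fails as stated.  The derivable part (clauses 2–4; the
structure modulo clause 1 BY NAME) is the positive companion `Discharge/Sec3Prop34CnstOfRlfR.lean`.  Content of the
gap: over abstract data the effective cone `{r ∈ ℝⁿ : Σ rᵢ·div(bᵢ) ≥ 0}` need not be spanned by its rational points
(here three `ℝ`-primes and an irrational lattice; with only `ℚ`-primes the same occurs for infinitely many primes, e.g.
over `∏_ℕ ℚ_{≥0}`); it is so spanned when `Φ₀(Y)` has finitely many primes none of them `ℝ`-monoprime (rational
polyhedral cone) — print's situation for a covering with finitely many irreducible components.  HONEST FRAMING: a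
statement about the cell's abstract interfaces, not about print's geometric data (for which Prop. 3.4 (ii) is a
theorem of [EtTh]); nothing here bears on [IUTchIII] Cor. 3.12.
-/

noncomputable section

namespace Literature.AnabelianGeometry.EtaleTheta

open CategoryTheory Opposite Literature.AlgebraicGeometry.Frobenioids NNReal

namespace Sec3Prop34CnstOfRlfRNegative

/-- `Φ₀ := ℝ_{≥0} × ℝ_{≥0} × ℝ_{≥0}` (multiplicatively: three perfect `ℝ`-monoprime factors).
[cite: MochizukiFrdI2008, Def. 2.4(i) p.47] -/
abbrev M : Type := Fin 3 → Multiplicative ℝ≥0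

/-- Each factor `ℝ_{≥0}` is (`ℝ`-)monoprime. [cite: MochizukiFrdI2008, §0 p.10] -/
theorem hP : ∀ _ : Fin 3, IsMonoprime (Multiplicative ℝ≥0) := fun _ => IsMonoprime.ofR ⟨⟨MulEquiv.refl _⟩⟩

/-- `ℝ` supports `ℝ_{≥0}³`: perfect, perf-factorial (a full product of perfect monoprime monoids), every
`M_𝔭 ≅ ℝ_{≥0}`. [cite: MochizukiFrdI2008, Def. 2.4(ii) p.48] -/
theorem supports_M : Supports M .R := by
  refine ⟨PiMonoprime.isPerfect (P := fun _ : Fin 3 => Multiplicative ℝ≥0) fun _ => isPerfect_multiplicative_nnreal,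
    PiMonoprime.isPerfFactorial (P := fun _ : Fin 3 => Multiplicative ℝ≥0) hP
      fun _ => isPerfect_multiplicative_nnreal, fun Q => ⟨⟨?_⟩⟩⟩
  exact PiMonoprime.submonoidEquiv (P := fun _ : Fin 3 => Multiplicative ℝ≥0) hP Q (PiMonoprime.idx hP Q)
    (PiMonoprime.primeOf_idx hP Q)

/-- The coordinate `δ_j(t)`: `t` at the `j`-th factor, `0` elsewhere (additive notation).
[cite: MochizukiFrdI2008, Def. 2.4(i) p.47] -/
def δ (j : Fin 3) (t : ℝ≥0) : M := Pi.mulSingle j (Multiplicative.ofAdd t)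

/-- The `j`-th coordinate as a real number: `M → (ℝ, +)` (written multiplicatively).
[cite: MochizukiFrdI2008, Def. 2.4(i) p.47] -/
def coordHom (j : Fin 3) : M →* Multiplicative ℝ :=
  (AddMonoidHom.toMultiplicative NNReal.toRealHom.toAddMonoidHom).comp
    (Pi.evalMonoidHom (fun _ : Fin 3 => Multiplicative ℝ≥0) j)

/-- `coordHom j m = (m_j : ℝ)`. [cite: MochizukiFrdI2008, Def. 2.4(i) p.47] -/
theorem toAdd_coordHom (j : Fin 3) (m : M) :
    Multiplicative.toAdd (coordHom j m) = ((Multiplicative.toAdd (m j) : ℝ≥0) : ℝ) := rfl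

/-- Coordinates of `δ_i(t)`. [cite: MochizukiFrdI2008, Def. 2.4(i) p.47] -/
theorem toAdd_coordHom_δ (i j : Fin 3) (t : ℝ≥0) :
    Multiplicative.toAdd (coordHom j (δ i t)) = if j = i then (t : ℝ) else 0 := by
  rw [toAdd_coordHom, δ]
  by_cases h : j = i
  · subst h
    rw [Pi.mulSingle_eq_same, toAdd_ofAdd, if_pos rfl]
  · rw [Pi.mulSingle_eq_of_ne h, toAdd_one, if_neg h, NNReal.coe_zero]

/-- The `ℝ_{>0}`-action of Def. 2.4 (ii) on `ℝ_{≥0}³` is coordinatewise multiplication.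
[cite: MochizukiFrdI2008, Def. 2.4(ii) p.48] -/
theorem toAdd_coordHom_realPow (j : Fin 3) (r : ℝ≥0) (a : M) :
    Multiplicative.toAdd (coordHom j (supports_M.realPow r a)) = r * Multiplicative.toAdd (coordHom j a) := by
  rw [toAdd_coordHom, toAdd_coordHom]
  have h := Supports.hom_nnreal_realPow supports_M (Pi.evalMonoidHom (fun _ : Fin 3 => Multiplicative ℝ≥0) j) r a
  rw [Pi.evalMonoidHom_apply, Pi.evalMonoidHom_apply] at h
  rw [h, NNReal.coe_mul]

/-! ### The rational function monoid `B₀ := ℤ²` and `B₀ → Φ₀^gp` -/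

/-- `√2 ∈ ℝ_{≥0}`. [folklore] -/
abbrev rt2 : ℝ≥0 := NNReal.sqrt 2
/-- `l₁ := δ₀(1)`; below `l₂ := δ₁(1)`, `e₃ := δ₂(1)`, `m₁ := l₁^{√2} · e₃`, `m₂ := l₂^{√2}`.
[cite: MochizukiEtTh2009, Def 3.3 p.73] -/
def l₁ : M := δ 0 1
/-- see `l₁`. [cite: MochizukiEtTh2009, Def 3.3 p.73] -/
def l₂ : M := δ 1 1
/-- see `l₁`. [cite: MochizukiEtTh2009, Def 3.3 p.73] -/
def e₃ : M := δ 2 1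
/-- see `l₁`. [cite: MochizukiEtTh2009, Def 3.3 p.73] -/
def m₁ : M := supports_M.realPow rt2 l₁ * e₃
/-- see `l₁`. [cite: MochizukiEtTh2009, Def 3.3 p.73] -/
def m₂ : M := supports_M.realPow rt2 l₂

/-- `u := [l₁]/[l₂] = (1, -1, 0) ∈ Φ₀^gp`. [cite: MochizukiEtTh2009, Def 3.3 p.73] -/
def u : Algebra.GrothendieckGroup M := Algebra.GrothendieckGroup.of l₁ / Algebra.GrothendieckGroup.of l₂
/-- `v := [m₁]/[m₂] = (√2, -√2, 1) ∈ Φ₀^gp`. [cite: MochizukiEtTh2009, Def 3.3 p.73] -/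
def v : Algebra.GrothendieckGroup M := Algebra.GrothendieckGroup.of m₁ / Algebra.GrothendieckGroup.of m₂

/-- `B₀ := ℤ × ℤ` (multiplicatively). [cite: MochizukiEtTh2009, Def 3.3 p.73] -/
abbrev B : Type := Multiplicative ℤ × Multiplicative ℤ
/-- `B₀ → Φ₀^gp`, `(a, b) ↦ u^a · v^b`. [cite: MochizukiEtTh2009, Def 3.3 p.73] -/
def divH : B →* Algebra.GrothendieckGroup M := MonoidHom.coprod (zpowersHom _ u) (zpowersHom _ v)

/-- `divH (a, b) = u^a · v^b`. [cite: MochizukiEtTh2009, Def 3.3 p.73] -/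
theorem divH_apply (g : B) : divH g = u ^ Multiplicative.toAdd g.1 * v ^ Multiplicative.toAdd g.2 := by
  rw [divH, MonoidHom.coprod_apply, zpowersHom_apply, zpowersHom_apply]

/-- The `j`-th coordinate extended to `Φ₀^gp → ℝ`. [cite: MochizukiEtTh2009, Def 3.3 p.73] -/
def coordGp (j : Fin 3) : Algebra.GrothendieckGroup M →* Multiplicative ℝ :=
  Algebra.GrothendieckGroup.lift (coordHom j)

/-- `coordGp j [m] = coordHom j m`. [cite: MochizukiEtTh2009, Def 3.3 p.73] -/
theorem coordGp_of (j : Fin 3) (m : M) : coordGp j (Algebra.GrothendieckGroup.of m) = coordHom j m := by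
  have h := Algebra.GrothendieckGroup.lift.symm_apply_apply (coordHom j)
  rw [Algebra.GrothendieckGroup.lift_symm_apply] at h
  exact DFunLike.congr_fun h m

/-- The real coordinate `c_j(g) := toAdd (coordGp j g)`. [cite: MochizukiEtTh2009, Def 3.3 p.73] -/
def c (j : Fin 3) (g : Algebra.GrothendieckGroup M) : ℝ := Multiplicative.toAdd (coordGp j g)

/-- `c_j` is additive. [folklore] -/
private theorem c_mul (j : Fin 3) (g g' : Algebra.GrothendieckGroup M) : c j (g * g') = c j g + c j g' := by
  rw [c, map_mul, toAdd_mul, c, c]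
/-- `c_j` on quotients. [folklore] -/
private theorem c_div (j : Fin 3) (g g' : Algebra.GrothendieckGroup M) : c j (g / g') = c j g - c j g' := by
  rw [c, map_div, toAdd_div, c, c]
/-- `c_j` on powers. [folklore] -/
private theorem c_zpow (j : Fin 3) (g : Algebra.GrothendieckGroup M) (n : ℤ) : c j (g ^ n) = n * c j g := by
  rw [c, map_zpow, toAdd_zpow, c, zsmul_eq_mul]

/-- `c_j [m] = m_j`. [folklore] -/
private theorem c_of (j : Fin 3) (m : M) : c j (Algebra.GrothendieckGroup.of m) = Multiplicative.toAdd (coordHom j m) := by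
  rw [c, coordGp_of]

/-- `c_j [m] ≥ 0`. [folklore] -/
private theorem c_of_nonneg (j : Fin 3) (m : M) : 0 ≤ c j (Algebra.GrothendieckGroup.of m) := by
  rw [c_of, toAdd_coordHom]
  exact NNReal.coe_nonneg _

/-- Coordinates of `divH (a, b) = a·u + b·v = (a + b√2, -(a + b√2), b)`. [cite: MochizukiEtTh2009, Def 3.3 p.73] -/
theorem c_divH (g : B) (j : Fin 3) :
    c j (divH g) = ((Multiplicative.toAdd g.1 : ℤ) : ℝ) * ((if j = 0 then (1 : ℝ) else 0) - (if j = 1 then 1 else 0)) +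
      ((Multiplicative.toAdd g.2 : ℤ) : ℝ) * (((if j = 0 then ((rt2 : ℝ≥0) : ℝ) else 0) +
        (if j = 2 then (1 : ℝ) else 0)) - (if j = 1 then ((rt2 : ℝ≥0) : ℝ) else 0)) := by
  rw [divH_apply, c_mul, c_zpow, c_zpow, u, v, c_div, c_div, c_of, c_of, c_of, c_of, m₁, m₂, map_mul, toAdd_mul,
    toAdd_coordHom_realPow, toAdd_coordHom_realPow, l₁, l₂, e₃]
  simp only [toAdd_coordHom_δ]
  split_ifs <;> push_cast <;> ring

/-- **Effective locus and kernel of `B₀ → Φ₀^gp` are trivial**: if all three coordinates of `divH (a, b)` are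
`≥ 0` then `(a, b) = 0` — the third gives `b ≥ 0`, the first two `a + b√2 = 0`, and `√2` is irrational.
[cite: MochizukiEtTh2009, Prop 3.4 (ii) p.74] -/
theorem eq_one_of_c_divH_nonneg (g : B) (h : ∀ j, 0 ≤ c j (divH g)) : g = 1 := by
  obtain ⟨a, b⟩ := g
  have h0 := h 0
  have h1 := h 1
  have h2 := h 2
  simp only [c_divH, Fin.isValue, if_true, show (0 : Fin 3) ≠ 1 by decide, show (1 : Fin 3) ≠ 0 by decide,
    show (1 : Fin 3) ≠ 2 by decide, show (2 : Fin 3) ≠ 0 by decide, show (2 : Fin 3) ≠ 1 by decide,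
    show (0 : Fin 3) ≠ 2 by decide, if_false] at h0 h1 h2
  rw [show ((rt2 : ℝ≥0) : ℝ) = Real.sqrt 2 from Real.coe_sqrt] at h0 h1
  have hsum : ((Multiplicative.toAdd a : ℤ) : ℝ) + ((Multiplicative.toAdd b : ℤ) : ℝ) * Real.sqrt 2 = 0 := by
    linarith
  by_cases hb : Multiplicative.toAdd b = 0
  · have ha : ((Multiplicative.toAdd a : ℤ) : ℝ) = 0 := by
      rw [hb, Int.cast_zero, zero_mul, add_zero] at hsum; exact hsum
    exact Prod.ext (Multiplicative.toAdd.injective (by exact_mod_cast ha)) (Multiplicative.toAdd.injective hb)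
  · exfalso
    apply irrational_sqrt_two.ne_rat (-((Multiplicative.toAdd a : ℤ) : ℚ) / ((Multiplicative.toAdd b : ℤ) : ℚ))
    have hbne : (((Multiplicative.toAdd b : ℤ) : ℚ) : ℝ) ≠ 0 := by exact_mod_cast hb
    rw [Rat.cast_div, eq_div_iff hbne]
    push_cast
    linarith

/-! ### The Def. 3.3 (iii) data `dm₀` over the one-object base category; Prop. 3.4 holds for them -/

/-- **The data `(Φ₀, B₀, B₀ → Φ₀^gp, F₀)`**: `Φ₀ = ℝ_{≥0}³`, `B₀ = ℤ²`, `div₀ = divH`, `F₀ = 0`, everything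
non-cuspidal, over the one-object base category. [cite: MochizukiEtTh2009, Def 3.3 p.73] -/
def dm₀ : DivisorMonoids.{0, 0, 0} (Discrete PUnit.{1}) where
  Φ₀ := (Functor.const _).obj (CommMonCat.of M)
  B₀ := (Functor.const _).obj (CommMonCat.of B)
  isUnit_B₀ _ b := by
    change IsUnit (M := B) b
    exact Group.isUnit _
  div₀ _ := divH
  div₀_natural _ b := by
    change divH b = gpMap (MonoidHom.id M) (divH b)
    rw [gpMap_eq_monGpMap, MonGp.map_id, MonoidHom.id_apply]
  F₀ _ := ⊥
  F₀_map _ _ hb := hb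
  ncsp₀ _ := ⊤
  csp₀ _ := ⊥
  ncsp₀_map _ _ _ := trivial
  csp₀_map _ x hx := by
    rw [Submonoid.mem_bot] at hx ⊢
    rw [hx, map_one]
  existsUnique_ncsp_csp _ x := by
    refine ⟨(⟨x, trivial⟩, ⟨1, Submonoid.mem_bot.mpr rfl⟩), mul_one x, ?_⟩
    rintro ⟨a, c⟩ h
    have hc : c.1 = 1 := Submonoid.mem_bot.mp c.2
    have ha : a.1 = x := by
      have h' : a.1 * c.1 = x := h
      rwa [hc, mul_one] at h'
    exact Prod.ext (Subtype.ext ha) (Subtype.ext hc)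

/-- `Φ₀(Y) = ℝ_{≥0}³` is perf-factorial (Prop. 3.4 (i) for `dm₀`, the constructor's hypothesis).
[cite: MochizukiEtTh2009, Prop 3.4 p.74] -/
theorem hpf₀ : ∀ Y : (Discrete PUnit.{1})ᵒᵖ, IsPerfFactorial (dm₀.Φ₀.obj Y) :=
  fun _ => supports_M.isPerfFactorial

/-- **Prop. 3.4 for `dm₀` over the TREE's [FrdI] vocabulary**: `Φ₀` perf-factorial, identity endomorphisms
non-dilating, `Φ₀` a divisorial monoid on the one-object category, and — the two clauses with content —
kernel and effective locus of `B₀ → Φ₀^gp` inside `F₀ = 0`. [cite: MochizukiEtTh2009, Prop 3.4 p.74] -/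
theorem prop34 (IsRat IsSRat : ((Discrete PUnit.{1})ᵒᵖ ⥤ CommMonCat.{0}) → Prop) :
    dm₀.Prop34 treeMonoidVocab (treeCatVocab (Discrete PUnit.{1}) IsRat IsSRat) where
  isPerfFactorial Y := hpf₀ Y
  isNonDilating Y f _ := by
    change associatesMap (MonoidHom.id M) = MonoidHom.id _
    ext x
    obtain ⟨m, rfl⟩ := Associates.mk_surjective x
    rw [associatesMap_mk]
    rfl
  isDivisorialOn := by
    refine ⟨⟨fun α => ⟨fun a b h => h, fun x y h => ?_⟩, fun α _ => Function.bijective_id⟩,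
      fun _ => PiMonoprime.isDivisorial (P := fun _ : Fin 3 => Multiplicative ℝ≥0) hP⟩
    obtain ⟨a, rfl⟩ := Associates.mk_surjective x
    obtain ⟨b, rfl⟩ := Associates.mk_surjective y
    rw [associatesMap_mk, associatesMap_mk] at h
    exact h
  ker_div₀_le_F₀ Y g hg := by
    change divH g = 1 at hg
    exact Submonoid.mem_bot.mpr (eq_one_of_c_divH_nonneg g fun j => by rw [hg, c, map_one, toAdd_one])
  mem_F₀_of_div₀_mem Y g x hg := by
    change divH g = Algebra.GrothendieckGroup.of x at hg
    exact Submonoid.mem_bot.mpr (eq_one_of_c_divH_nonneg g fun j => by rw [hg]; exact c_of_nonneg j x)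

/-- `Prop34Cnst₀` for `dm₀` and `cnst := 𝟭` (the one-object base has only identity morphisms).
[cite: MochizukiEtTh2009, Prop 3.4 (ii) p.74] -/
theorem prop34Cnst₀ : dm₀.Prop34Cnst₀ (𝟭 (Discrete PUnit.{1})) where
  B₀_map_eq_of_cnst_map_eq g g' _ _ _ := by rw [Subsingleton.elim g g']
  Φ₀_map_eq_of_cnst_map_eq g g' _ _ _ := by rw [Subsingleton.elim g g']
  cnst_map_eq_of_B₀_map_eq g g' _ := Subsingleton.elim _ _

/-! ### The element `β := v - √2·u ∈ ℝ·Φ₀^birat`: effective, not constant -/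

/-- The base object. [cite: MochizukiEtTh2009, Def 3.3 p.73] -/
def Y₀ : Discrete PUnit.{1} := ⟨PUnit.unit⟩

/-- The carrier `Φ₀(Y₀)` of `dm₀` (definitionally `ℝ_{≥0}³`, with the instance path of `dm₀`).
[cite: MochizukiEtTh2009, Def 3.3 p.73] -/
abbrev X : Type := (dm₀.Φ₀.obj (op Y₀) : Type)

/-- `(-r) • x = (r • x)⁻¹` in `(Φ^rlf)^gp` (from `rsmul_add`, `rsmul_zero`), for any realification datum.
[cite: MochizukiFrdI2008, Def. 2.4(i) p.48] -/
private theorem rsmul_neg {D : Type} [Category.{0} D] {Φ : Dᵒᵖ ⥤ CommMonCat.{0}} (R : RealificationData Φ)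
    (Z : D) (r : ℝ) (x : Algebra.GrothendieckGroup (R.rlf.obj (op Z))) : R.rsmul Z (-r) x = (R.rsmul Z r x)⁻¹ := by
  have h := R.rsmul_add Z r (-r) x
  rw [add_neg_cancel, R.rsmul_zero] at h
  exact eq_inv_of_mul_eq_one_right h.symm

/-- `ι^gp [m] = [ι m]` for THE realification data of `dm₀`, `ι = (M ≅ M^rlf)` (`Supports.rlfEquiv`).
[cite: MochizukiFrdI2008, Prop. 5.3 p.103] -/
theorem toRlfGp_of (m : M) :
    (RealifiedDivisorMonoids.realData dm₀ hpf₀).toRlfGp Y₀ (Algebra.GrothendieckGroup.of m) =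
      Algebra.GrothendieckGroup.of (supports_M.rlfEquiv m) := by
  rw [RealificationData.toRlfGp, MonGp.map_of]
  rfl

/-- **`r • ι^gp[a] = ι^gp[a^r]`** (`r ≥ 0`): on the image of `Φ₀` the scalar action of `(Φ₀^rlf)^gp` is the
`ℝ_{>0}`-action of Def. 2.4 (ii) on `Φ₀` (`realSMul_coe_of`, `rlfEquiv_realPow`).
[cite: MochizukiFrdI2008, Def. 2.4(ii) p.48] -/
theorem rsmul_toRlfGp_of (r : ℝ≥0) (a : M) :
    (RealifiedDivisorMonoids.realData dm₀ hpf₀).rsmul Y₀ (r : ℝ)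
        ((RealifiedDivisorMonoids.realData dm₀ hpf₀).toRlfGp Y₀ (Algebra.GrothendieckGroup.of a)) =
      (RealifiedDivisorMonoids.realData dm₀ hpf₀).toRlfGp Y₀
        (Algebra.GrothendieckGroup.of (supports_M.realPow r a)) := by
  rw [toRlfGp_of, toRlfGp_of, supports_M.rlfEquiv_realPow]
  exact IsPerfFactorial.Rlf.realSMul_coe_of supports_M.isPerfFactorial r (supports_M.rlfEquiv a)

/-- `β := ι^gp(div₀ e₂) · (-√2) • ι^gp(div₀ e₁) ∈ (Φ₀^rlf)^gp(Y₀)` — additively `v - √2·u = (0, 0, 1)`.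
[cite: MochizukiEtTh2009, Def 3.6 p.76] -/
def β : Algebra.GrothendieckGroup ((RealifiedDivisorMonoids.realData dm₀ hpf₀).rlf.obj (op Y₀)) :=
  (RealifiedDivisorMonoids.realData dm₀ hpf₀).toRlfGp Y₀ (dm₀.div₀ (op Y₀) (1, Multiplicative.ofAdd 1)) *
    (RealifiedDivisorMonoids.realData dm₀ hpf₀).rsmul Y₀ (-((rt2 : ℝ≥0) : ℝ))
      ((RealifiedDivisorMonoids.realData dm₀ hpf₀).toRlfGp Y₀ (dm₀.div₀ (op Y₀) (Multiplicative.ofAdd 1, 1)))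

/-- `div₀(e₁) = u = [l₁]/[l₂]`, typed over the data `dm₀`. [cite: MochizukiEtTh2009, Def 3.3 p.73] -/
theorem div₀_inl : dm₀.div₀ (op Y₀) (Multiplicative.ofAdd 1, 1) =
    Algebra.GrothendieckGroup.of (M := X) l₁ / Algebra.GrothendieckGroup.of (M := X) l₂ := by
  change divH _ = _
  rw [divH_apply, toAdd_ofAdd, zpow_one, toAdd_one, zpow_zero, mul_one, u]; rfl

/-- `div₀(e₂) = v = [m₁]/[m₂]`, typed over the data `dm₀`. [cite: MochizukiEtTh2009, Def 3.3 p.73] -/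
theorem div₀_inr : dm₀.div₀ (op Y₀) (1, Multiplicative.ofAdd 1) =
    Algebra.GrothendieckGroup.of (M := X) m₁ / Algebra.GrothendieckGroup.of (M := X) m₂ := by
  change divH _ = _
  rw [divH_apply, toAdd_one, zpow_zero, one_mul, toAdd_ofAdd, zpow_one, v]; rfl

/-- `β ∈ ℝ·Φ₀^birat(Y₀) = B₀^ℝ(Y₀)` (product of the generators `1 • ι(v)`, `(-√2) • ι(u)`, `u, v ∈ Φ₀^birat`).
[cite: MochizukiEtTh2009, Def 3.6 p.76] -/
theorem β_mem : β ∈ ((RealifiedDivisorMonoids.realData dm₀ hpf₀).realSpan dm₀.biratGp).carrier Y₀ := by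
  refine Subgroup.mul_mem _
    (Subgroup.subset_closure ⟨1, dm₀.div₀ (op Y₀) (1, Multiplicative.ofAdd 1), ?_, ?_⟩)
    (Subgroup.subset_closure ⟨_, dm₀.div₀ (op Y₀) (Multiplicative.ofAdd 1, 1), ?_, rfl⟩)
  · exact Subgroup.subset_closure ⟨(1, Multiplicative.ofAdd 1), rfl⟩
  · exact ((RealifiedDivisorMonoids.realData dm₀ hpf₀).rsmul_one Y₀ _).symm
  · exact Subgroup.subset_closure ⟨(Multiplicative.ofAdd 1, 1), rfl⟩

/-- The monoid identity behind `v - √2·u = (0,0,1)`: `m₁ · l₂^{√2} = e₃ · (m₂ · l₁^{√2})` (`m₁ = l₁^{√2} · e₃`,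
`m₂ = l₂^{√2}`; pure commutativity). [cite: MochizukiEtTh2009, Def 3.6 p.76] -/
theorem m₁_mul : m₁ * supports_M.realPow rt2 l₂ = e₃ * (m₂ * supports_M.realPow rt2 l₁) := by
  rw [m₁, m₂]
  ac_rfl

/-- The same identity read in `Φ₀(Y₀)^gp` (typed over `dm₀`): `[m₁ · l₂^{√2}] / [m₂ · l₁^{√2}] = [e₃]`.
[cite: MochizukiEtTh2009, Def 3.6 p.76] -/
theorem of_m₁_mul :
    Algebra.GrothendieckGroup.of (M := X) (HMul.hMul (α := X) (β := X) m₁ (supports_M.realPow rt2 l₂)) /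
        Algebra.GrothendieckGroup.of (M := X) (HMul.hMul (α := X) (β := X) m₂ (supports_M.realPow rt2 l₁)) =
      Algebra.GrothendieckGroup.of (M := X) e₃ := by
  have h : HMul.hMul (α := X) (β := X) m₁ (supports_M.realPow rt2 l₂) =
      HMul.hMul (α := X) (β := X) e₃ (HMul.hMul (α := X) (β := X) m₂ (supports_M.realPow rt2 l₁)) := m₁_mul
  rw [h, map_mul, mul_div_cancel_right]

/-- **`β` is EFFECTIVE**: `β = ι^gp[e₃]`, the class of the element `ι(e₃) = ι(0,0,1) ∈ Φ₀^rlf(Y₀)`.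
[cite: MochizukiEtTh2009, Def 3.6 p.76] -/
theorem β_eq : β = (RealifiedDivisorMonoids.realData dm₀ hpf₀).toRlfGp Y₀ (Algebra.GrothendieckGroup.of e₃) := by
  rw [β, rsmul_neg, div₀_inr, div₀_inl, map_div, map_div, map_div, rsmul_toRlfGp_of, rsmul_toRlfGp_of, inv_div,
    div_mul_div_comm, ← map_mul, ← map_mul, ← map_mul, ← map_mul, ← map_div, of_m₁_mul]

/-- `ℝ·Φ₀^cnst(Y₀) = 0` (as `F₀ = 0`): every element of the `ℝ`-span of `Φ₀^cnst` is trivial.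
[cite: MochizukiEtTh2009, Def 3.6 p.76] -/
theorem eq_one_of_mem_realSpan_cnstGp
    {x : Algebra.GrothendieckGroup ((RealifiedDivisorMonoids.realData dm₀ hpf₀).rlf.obj (op Y₀))}
    (hx : x ∈ ((RealifiedDivisorMonoids.realData dm₀ hpf₀).realSpan dm₀.cnstGp).carrier Y₀) : x = 1 := by
  have hle : ((RealifiedDivisorMonoids.realData dm₀ hpf₀).realSpan dm₀.cnstGp).carrier Y₀ ≤ ⊥ := by
    refine (Subgroup.closure_le _).mpr ?_
    rintro _ ⟨r, c, hc, rfl⟩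
    have hle' : dm₀.cnstGp.carrier Y₀ ≤ ⊥ := by
      refine (Subgroup.closure_le _).mpr ?_
      rintro _ ⟨g, hg, rfl⟩
      rw [show g = 1 from Submonoid.mem_bot.mp hg, map_one]
      exact (⊥ : Subgroup _).one_mem
    rw [show c = 1 from Subgroup.mem_bot.mp (hle' hc), map_one, map_one]
    exact (⊥ : Subgroup _).one_mem
  exact Subgroup.mem_bot.mp (hle hx)

/-- **`Prop34Cnst (ofRlfR dm₀ hpf₀) (𝟭 _)` FAILS**: its first clause would put the effective element
`β = ι^gp[e₃]` (`e₃ = (0,0,1) ≠ 0`) of `B₀^ℝ(Y₀) = ℝ·Φ₀^birat(Y₀)` into `F₀^ℝ(Y₀) = ℝ·Φ₀^cnst(Y₀) = 0`.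
[cite: MochizukiEtTh2009, Prop 3.4 (ii) p.74] -/
theorem not_prop34Cnst_ofRlfR :
    ¬ (RealifiedDivisorMonoids.ofRlfR dm₀ hpf₀).Prop34Cnst (𝟭 (Discrete PUnit.{1})) := by
  intro h
  have heq : (RealifiedDivisorMonoids.ofRlfR dm₀ hpf₀).divΛ (op Y₀) ⟨β, β_mem⟩ =
      Algebra.GrothendieckGroup.of (((RealifiedDivisorMonoids.realData dm₀ hpf₀).toRlf.app (op Y₀)).hom e₃) := by
    change β = _
    rw [β_eq, RealificationData.toRlfGp, MonGp.map_of]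
  have hβ1 : β = 1 := eq_one_of_mem_realSpan_cnstGp (h.mem_FΛ_of_divΛ_eq_of (op Y₀) ⟨β, β_mem⟩ _ heq)
  rw [β_eq, RealificationData.toRlfGp, MonGp.map_of] at hβ1
  have h1 : Algebra.GrothendieckGroup.of (1 : (hpf₀ (op Y₀)).Rlf) = 1 := map_one _
  have hx : supports_M.rlfEquiv e₃ = 1 :=
    (IsPerfFactorial.Rlf.isIntegral (hpf₀ (op Y₀))).injective_of (hβ1.trans h1.symm)
  have h2 := congr_fun (supports_M.rlfEquiv.map_eq_one_iff.mp hx) 2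
  rw [e₃, δ, Pi.mulSingle_eq_same, Pi.one_apply] at h2
  exact one_ne_zero (Multiplicative.ofAdd.injective h2 : (1 : ℝ≥0) = 0)

/-- **The row «EtTh:Thm3.7(iii)/L10-R» as posed is FALSE**: `Prop34 ∧ Prop34Cnst₀ ⇏ Prop34Cnst (ofRlfR dm hpf)`,
even over the tree's [FrdI] vocabularies — witnessed by `dm₀` (`Φ₀ = ℝ_{≥0}³`,
`B₀ = ℤ·(1,-1,0) ⊕ ℤ·(√2,-√2,1)`, `F₀ = 0`) over the one-object base category with `cnst = 𝟭` (universe-`0`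
instance of the universally quantified statement; the derivable part is `Discharge/Sec3Prop34CnstOfRlfR.lean`).
[cite: MochizukiEtTh2009, Prop 3.4 (ii) p.74] -/
theorem not_forall_prop34Cnst_ofRlfR :
    ¬ ∀ (D₀ : Type) [Category.{0} D₀] (dm : DivisorMonoids.{0, 0, 0} D₀)
        (hpf : ∀ Y : D₀ᵒᵖ, IsPerfFactorial (dm.Φ₀.obj Y)) (V : FrdIMonoidStub.{0})
        (V₀ : FrdICatStub.{0, 0, 0} D₀) (Dcnst : Type) [Category.{0} Dcnst] (cnst : D₀ ⥤ Dcnst),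
        dm.Prop34 V V₀ → dm.Prop34Cnst₀ cnst → (RealifiedDivisorMonoids.ofRlfR dm hpf).Prop34Cnst cnst :=
  fun h => not_prop34Cnst_ofRlfR (h _ dm₀ hpf₀ treeMonoidVocab
    (treeCatVocab (Discrete PUnit.{1}) (fun _ => True) (fun _ => True)) _ (𝟭 _)
    (prop34 (fun _ => True) (fun _ => True)) prop34Cnst₀)

end Sec3Prop34CnstOfRlfRNegative

end Literature.AnabelianGeometry.EtaleTheta

end
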